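import Summits.BirchSwinnertonDyer.BirchSwinnertonDyer.Theorems.AdditiveKolyvaginRoadRamifiedHabitatSignLawPotMultAnyLevel
import Summits.BirchSwinnertonDyer.Rank1Residual.AdditivePotMult.PStarTwistModel
import Summits.BirchSwinnertonDyer.Rank1Residual.Additive.DictionaryUniform
import Literature.NumberTheory.EllipticCurves.BSDSelmerSkinnerThmBProofs
import HarnessLib

/-!
# Route `AdditiveBranchIMC` (rung K1), crux `MultLower` (stmt-BirchSwinnertonDyer-19359), line `tame_roads_mult`
# v4, stub `stub_fieldSupplyM`: FIELD 2, step 0 — the SIGN LAW at the additive potentially multiplicative `p`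
# from the MULTIPLICATIVE twist model (no Tate valuations)

Cell `bsd-addord`, seat `bsd-line-addord-w2`. THEOREMS ONLY; no definition, no named fact, no `sorry`.

On the (M) cell the auxiliary rank-one twist `X ≅ E^{(p*T)}` of FIELD 2 is twisted by a discriminant
RAMIFIED at the additive prime `p`, so the coprime twisting law does not give its sign. The tree's
`RamifiedHabitat.rootNumber_mul_rootNumber_ramifiedTwist_of_potMult_anyLevel` does, but reads the row off
the Tate valuations `ord_p c₄ = 2`, `ord_p Δ > 6` of the minimal model. Here the same modular identity
(`rootNumber_mul_rootNumber_pStarTwist_eq_legendreSym_mul_χ₄_mul_of_mult`, assuming only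
`exists_isNewformOf`) is fed DIRECTLY with «`E^{(p*)}` is multiplicative at `p`» — which is how the (M) cell
is presented in the line (`AdditivePotMult.PotMult.exists_mult_pStar_twist_model`: `W ≅ V^{(p*)}`, `V`
multiplicative at `p`) — and `f_p(E) = 2` (`condExpTwo_of_addv_of_five_le`):

* `conductorNorm_eq_mul_sq_of_addv` — `N_E = M p²`, `p ∤ M`, at an additive `p ≥ 5`;
* `rootNumber_mul_rootNumber_pStarTwist_of_multTwist` — `w(E)·w(E^{(p*)}) = (M/p)·(−1/p)·W_p(E^{(p*)})`;
* `rootNumber_mul_rootNumber_ramifiedTwist_of_multTwist` — `w(E)·w(E^{(p*d')}) = −(d'/p)·W_p(E^{(p*)})`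
  for `d' ≡ 1 (4)` squarefree prime to `N_E`, `p*d' < 0`, every bad prime `≠ p` split in `ℚ(√(p*d'))`;
* `rootNumber_mul_rootNumber_ramifiedTwist_of_mult_model` — the same with `W_p(E^{(p*)}) = −a_p(V)`
  (`−1` if `V` is split, `+1` if non-split; Rohrlich Prop. 2(ii)) for a multiplicative model `C • V^{(p*)} = W`.

References: [Rohrlich1993Compositio] Prop. 2(ii),(iii); [AtkinLehner1970] §6; [KellockDokchitser2023] Rem. 2.2;
[MurtyMurty1997] Ch. 6 §1; [SilvermanATAEC1994] IV.10.2(b), IV.10.4.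
-/

set_option autoImplicit false
set_option linter.dupNamespace false

noncomputable section

open scoped Classical NumberTheorySymbols

open scoped MatrixGroups

open CongruenceSubgroup IsDedekindDomain IsDedekindDomain.HeightOneSpectrum Rat.HeightOneSpectrum WeierstrassCurve
  Literature.NumberTheory.EllipticCurves Literature.NumberTheory.EllipticCurves.ModularForms
  Literature.NumberTheory.EllipticCurves.Rank1Residual
  Summit.BirchSwinnertonDyer.Rank1Residual Summit.BirchSwinnertonDyer.Rank1Residual.Additive
  Summit.BirchSwinnertonDyer.BirchSwinnertonDyer.Theorems.AdditiveKoly.RamifiedHabitat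

namespace Summit.BirchSwinnertonDyer.BirchSwinnertonDyer.Theorems.ThreeFieldRoadSupply

section Sign

variable (W : WeierstrassCurve ℚ) [W.IsElliptic] (p : ℕ) [hp : Fact p.Prime]

/-- **`N_E = M·p²` with `p ∤ M` at an additive prime `p ≥ 5`** (`f_p(E) = 2`, Silverman ATAEC IV.10.4; tree:
`condExpTwo_of_addv_of_five_le`, `factorization_conductorNorm_holds`).
[cite: SilvermanATAEC1994, IV.10.2(b) and IV.10.4] -/
theorem conductorNorm_eq_mul_sq_of_addv (hp5 : 5 ≤ p) (hadd : Addv W p) :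
    ∃ M : ℕ, W.conductorNorm ℤ = M * p ^ 2 ∧ ¬ p ∣ M := by
  have h2 : condExp W p = 2 := condExpTwo_of_addv_of_five_le W p hp5 hadd
  have hf : (W.conductorNorm ℤ).factorization (natGenerator (placeOf p)) =
      W.conductorExponent (placeOf p) :=
    WeierstrassCurve.factorization_conductorNorm_holds W (placeOf p)
  have hgen : natGenerator (placeOf p) = p :=
    congrArg Subtype.val ((primesEquiv (R := ℤ)).apply_symm_apply ⟨p, hp.out⟩)
  rw [hgen] at hf
  unfold condExp at h2
  rw [h2] at hf
  have hN0 : W.conductorNorm ℤ ≠ 0 := (W.conductorNorm_pos_holds).ne'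
  have hdvd : p ^ 2 ∣ W.conductorNorm ℤ := by
    rw [← hf]; exact Nat.ordProj_dvd (W.conductorNorm ℤ) p
  have hndvd : ¬ p ^ 3 ∣ W.conductorNorm ℤ := by
    rw [show 3 = (W.conductorNorm ℤ).factorization p + 1 by rw [hf]]
    exact Nat.pow_succ_factorization_not_dvd hN0 hp.out
  obtain ⟨M, hM⟩ := hdvd
  refine ⟨M, by rw [hM, mul_comm], fun hk ↦ hndvd ?_⟩
  obtain ⟨k, hk⟩ := hk
  exact ⟨k, by rw [hM, hk]; ring⟩

/-- **`w(E)·w(E^{(p*)}) = (M/p)·(−1/p)·W_p(E^{(p*)})` when `E^{(p*)}` is MULTIPLICATIVE at `p`**, `N_E = M p²`,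
`p ≥ 5`, `p ∤ M`, assuming only the Modularity Theorem: the tree's
`rootNumber_mul_rootNumber_pStarTwist_of_potMult_anyLevel` with its Tate-valuation input replaced by the
reduction type of the twist (`N_{E^{(p*)}} = M p` by `conductorNorm_pStarTwist_eq_mul_of_mult`; `λ_p(f') = W_p(E')`
at `p ∥ N_{E'}` by `atkinLehnerEigenvalueAt_eq_localRootNumberAt_of_not_sq_dvd`).
[cite: AtkinLehner1970, §6] [cite: KellockDokchitser2023, Rem. 2.2 and Thm. 2.3] -/
theorem rootNumber_mul_rootNumber_pStarTwist_of_multTwist (hmod : exists_isNewformOf) (hp5 : 5 ≤ p)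
    {M : ℕ} (hN : W.conductorNorm ℤ = M * p ^ 2) (hpM : ¬ p ∣ M)
    (hmult : (W.quadraticTwist (((-1 : ℤ) ^ (p / 2) * p : ℤ) : ℚ)).HasMultiplicativeReductionAtPrime p) :
    W.rootNumber * (W.quadraticTwist (((-1 : ℤ) ^ (p / 2) * p : ℤ) : ℚ)).rootNumber =
      legendreSym p M * ZMod.χ₄ p *
        ((W.quadraticTwist (((-1 : ℤ) ^ (p / 2) * p : ℤ) : ℚ)).baseChange ℚ_[p]).localRootNumber ℤ_[p] := by
  -- adapted from `RamifiedHabitat.rootNumber_mul_rootNumber_pStarTwist_of_potMult_anyLevel`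
  have hp' : p.Prime := hp.out
  have hp2 : p ≠ 2 := by omega
  have hdZ0 : ((-1 : ℤ) ^ (p / 2) * p : ℤ) ≠ 0 :=
    mul_ne_zero (pow_ne_zero _ (by norm_num)) (by exact_mod_cast hp'.ne_zero)
  have hd0 : (((((-1 : ℤ) ^ (p / 2) * p : ℤ)) : ℚ)) ≠ 0 := by exact_mod_cast hdZ0
  haveI hE' : (W.quadraticTwist (((-1 : ℤ) ^ (p / 2) * p : ℤ) : ℚ)).IsElliptic :=
    W.isElliptic_quadraticTwist hd0
  haveI : NeZero (W.conductorNorm ℤ) := ⟨(W.conductorNorm_pos_holds).ne'⟩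
  haveI : NeZero ((W.quadraticTwist (((-1 : ℤ) ^ (p / 2) * p : ℤ) : ℚ)).conductorNorm ℤ) :=
    ⟨((W.quadraticTwist _).conductorNorm_pos_holds).ne'⟩
  have hN' := conductorNorm_pStarTwist_eq_mul_of_mult W hp5 hN hpM hmult
  obtain ⟨f, hf⟩ := hmod W
  obtain ⟨f', hf'⟩ := hmod (W.quadraticTwist (((-1 : ℤ) ^ (p / 2) * p : ℤ) : ℚ))
  have h0 := rootNumber_mul_rootNumber_pStarTwist_eq_legendreSym_mul_χ₄_mul_of_mult W hp2 hN hpM hN' hf hf'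
  set P : Nat.Primes := ⟨p, hp'⟩ with hP
  have hPN' : (P : ℕ) ∣ (W.quadraticTwist (((-1 : ℤ) ^ (p / 2) * p : ℤ) : ℚ)).conductorNorm ℤ := by
    change p ∣ _; rw [hN']; exact ⟨M, by ring⟩
  have hPN'2 : ¬ (P : ℕ) ^ 2 ∣ (W.quadraticTwist (((-1 : ℤ) ^ (p / 2) * p : ℤ) : ℚ)).conductorNorm ℤ := by
    change ¬ p ^ 2 ∣ _; rw [hN']
    rintro ⟨k, hk⟩
    apply hpM
    refine ⟨k, Nat.eq_of_mul_eq_mul_right hp'.pos ?_⟩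
    calc M * p = p ^ 2 * k := hk
      _ = p * k * p := by ring
  have hl' : atkinLehnerEigenvalueAt f' p =
      (((W.quadraticTwist (((-1 : ℤ) ^ (p / 2) * p : ℤ) : ℚ)).baseChange ℚ_[p]).localRootNumber ℤ_[p] : ℂ) := by
    rw [← localRootNumberAt_primesEquiv_symm_holds _ P]
    exact (W.quadraticTwist _).atkinLehnerEigenvalueAt_eq_localRootNumberAt_of_not_sq_dvd hf' P hPN' hPN'2
  rw [hl'] at h0
  exact_mod_cast h0

/-- **`w(E)·w(E^{(p*d')}) = −(d'/p)·W_p(E^{(p*)})` when `E^{(p*)}` is MULTIPLICATIVE at `p`** — `N_E = M p²` (`p ≥ 5`,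
`p ∤ M`), `d' ≡ 1 (4)` squarefree prime to `N_E`, `p* d' < 0`, every prime of `M` split in `ℚ(√(p* d'))`; assuming
only the Modularity Theorem. The tree's `rootNumber_mul_rootNumber_ramifiedTwist_of_potMult_anyLevel` with the
Tate-valuation input replaced by the reduction type of `E^{(p*)}` (coprime twisting law on `E^{(p*)}`, the
previous theorem, `(M/p)² = 1`). [cite: MurtyMurty1997, Ch. 6 §1] [cite: Rohrlich1993Compositio, Prop. 2(ii),(iii)] -/
theorem rootNumber_mul_rootNumber_ramifiedTwist_of_multTwist (hmod : exists_isNewformOf) (hp5 : 5 ≤ p)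
    {M : ℕ} (hN : W.conductorNorm ℤ = M * p ^ 2) (hpM : ¬ p ∣ M)
    (hmult : (W.quadraticTwist (((-1 : ℤ) ^ (p / 2) * p : ℤ) : ℚ)).HasMultiplicativeReductionAtPrime p)
    {d' : ℤ} (hd'4 : d' % 4 = 1) (hd'sq : Squarefree d') (hgcd : Int.gcd d' (W.conductorNorm ℤ) = 1)
    (hneg : (-1 : ℤ) ^ (p / 2) * p * d' < 0)
    (hodd : ∀ q ∈ M.primeFactors, q ≠ 2 → J((-1 : ℤ) ^ (p / 2) * p * d' | q) = 1)
    (htwo : 2 ∣ M → ((-1 : ℤ) ^ (p / 2) * p * d') % 8 = 1) :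
    W.rootNumber * (W.quadraticTwist (((-1 : ℤ) ^ (p / 2) * p * d' : ℤ) : ℚ)).rootNumber =
      -legendreSym p d' *
        ((W.quadraticTwist (((-1 : ℤ) ^ (p / 2) * p : ℤ) : ℚ)).baseChange ℚ_[p]).localRootNumber ℤ_[p] := by
  -- adapted from `RamifiedHabitat.rootNumber_mul_rootNumber_ramifiedTwist_of_potMult_anyLevel`
  have hp' : p.Prime := hp.out
  have hp2 : p ≠ 2 := by omega
  have hdZ0 : ((-1 : ℤ) ^ (p / 2) * p : ℤ) ≠ 0 :=
    mul_ne_zero (pow_ne_zero _ (by norm_num)) (by exact_mod_cast hp'.ne_zero)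
  have hd0 : (((((-1 : ℤ) ^ (p / 2) * p : ℤ)) : ℚ)) ≠ 0 := by exact_mod_cast hdZ0
  haveI hE' : (W.quadraticTwist (((-1 : ℤ) ^ (p / 2) * p : ℤ) : ℚ)).IsElliptic :=
    W.isElliptic_quadraticTwist hd0
  have hM0 : M ≠ 0 := by
    intro h; rw [h, zero_mul] at hN; exact (W.conductorNorm_pos_holds).ne' hN
  have hA := rootNumber_mul_rootNumber_pStarTwist_of_multTwist W p hmod hp5 hN hpM hmult
  have hN' := conductorNorm_pStarTwist_eq_mul_of_mult W hp5 hN hpM hmult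
  have hgcd' : Int.gcd d' ((W.quadraticTwist (((-1 : ℤ) ^ (p / 2) * p : ℤ) : ℚ)).conductorNorm ℤ) = 1 := by
    rw [hN']
    have h1 := Int.isCoprime_iff_gcd_eq_one.mpr hgcd
    rw [hN] at h1
    push_cast at h1 ⊢
    rw [sq, ← mul_assoc] at h1
    exact Int.isCoprime_iff_gcd_eq_one.mp h1.of_mul_right_left
  have hB := ((W.quadraticTwist (((-1 : ℤ) ^ (p / 2) * p : ℤ) : ℚ)).rootNumber_quadraticTwist_of_emod_four_eq_one
    hmod hd'4 hd'sq hgcd').1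
  rw [quadraticTwist_quadraticTwist, hN'] at hB
  have hcast : ((((-1 : ℤ) ^ (p / 2) * p : ℤ) : ℚ)) * (d' : ℚ) = (((-1 : ℤ) ^ (p / 2) * p * d' : ℤ) : ℚ) := by
    push_cast; ring
  rw [hcast] at hB
  have hNe0 : NeZero d'.natAbs := ⟨Int.natAbs_ne_zero.mpr (by rintro rfl; norm_num at hd'4)⟩
  have hpodd : Odd p := (Nat.Prime.eq_two_or_odd' hp').resolve_left hp2
  have hJM : J(((M * p : ℕ) : ℤ) | d'.natAbs) = legendreSym p M * legendreSym p d' := by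
    rw [Nat.cast_mul, jacobiSym.mul_left, jacobiSym_natAbs_eq_legendreSym_of_split_anyLevel hp2 hd'4 hM0 hodd htwo,
      Literature.NumberTheory.QuadraticFields.jacobiSym_natAbs_eq_of_emod_four_eq_one hd'4 hpodd,
      ← jacobiSym.legendreSym.to_jacobiSym]
  have hJ1 := jacobiSym_neg_one_natAbs_eq_of_neg hp2 hd'4 hneg
  have hM2 : legendreSym p M * legendreSym p M = 1 := by
    rw [← sq]
    refine legendreSym.sq_one p ?_
    rw [Int.cast_natCast, ne_eq, ZMod.natCast_eq_zero_iff]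
    exact hpM
  have hχ₄ := χ₄_mul_self_of_ne_two (p := p) hp2
  set w' := ((W.quadraticTwist (((-1 : ℤ) ^ (p / 2) * p : ℤ) : ℚ)).baseChange ℚ_[p]).localRootNumber ℤ_[p]
  calc W.rootNumber * (W.quadraticTwist (((-1 : ℤ) ^ (p / 2) * p * d' : ℤ) : ℚ)).rootNumber
      = J(-1 | d'.natAbs) * J(((M * p : ℕ) : ℤ) | d'.natAbs) *
          (W.rootNumber * (W.quadraticTwist (((-1 : ℤ) ^ (p / 2) * p : ℤ) : ℚ)).rootNumber) := by rw [hB]; ring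
    _ = -ZMod.χ₄ p * (legendreSym p M * legendreSym p d') * (legendreSym p M * ZMod.χ₄ p * w') := by
        rw [hJ1, hJM, hA]
    _ = -legendreSym p d' * w' := by
        linear_combination (-(legendreSym p d') * w' * (ZMod.χ₄ p * ZMod.χ₄ p)) * hM2 - (legendreSym p d' * w') * hχ₄

/-- **The (M)-cell sign law in the line's presentation.** `W` additive at `p ≥ 5` with a model
`C • V^{(p*)} = W`, `V` MULTIPLICATIVE at `p`; `d' ≡ 1 (4)` squarefree prime to `N_W`, `p* d' < 0`, every bad prime
`ℓ ≠ p` of `W` split in `ℚ(√(p* d'))`. Then, assuming only the Modularity Theorem,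
`w(W)·w(W^{(p* d')}) = −(d'/p)·W_p(V)` with `W_p(V) = −1` if `V` is split and `+1` if `V` is non-split at `p`
(Rohrlich Prop. 2(ii)); `W^{(p*)} ≅ V` by `(V^{(p*)})^{(p*)} = V^{(p*²)} ≅ V`.
[cite: Rohrlich1993Compositio, Prop. 2(ii),(iii)] [cite: MurtyMurty1997, Ch. 6 §1] -/
theorem rootNumber_mul_rootNumber_ramifiedTwist_of_mult_model (hmod : exists_isNewformOf) (hp5 : 5 ≤ p)
    (hadd : Addv W p) (V : WeierstrassCurve ℚ) [V.IsElliptic] (C : VariableChange ℚ)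
    (hC : C • V.quadraticTwist ((-1 : ℚ) ^ (p / 2) * p) = W) (hmultV : V.HasMultiplicativeReductionAtPrime p)
    {d' : ℤ} (hd'4 : d' % 4 = 1) (hd'sq : Squarefree d') (hgcd : Int.gcd d' (W.conductorNorm ℤ) = 1)
    (hneg : (-1 : ℤ) ^ (p / 2) * p * d' < 0)
    (hodd : ∀ ℓ : ℕ, ℓ.Prime → ℓ ∣ W.conductorNorm ℤ → ℓ ≠ p → ℓ ≠ 2 → J((-1 : ℤ) ^ (p / 2) * p * d' | ℓ) = 1)
    (htwo : 2 ∣ W.conductorNorm ℤ → ((-1 : ℤ) ^ (p / 2) * p * d') % 8 = 1) :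
    W.rootNumber * (W.quadraticTwist (((-1 : ℤ) ^ (p / 2) * p * d' : ℤ) : ℚ)).rootNumber =
      -legendreSym p d' * (if V.HasSplitMultiplicativeReductionAtPrime p then -1 else 1) := by
  have hp' : p.Prime := hp.out
  have hp2 : p ≠ 2 := by omega
  obtain ⟨M, hN, hpM⟩ := conductorNorm_eq_mul_sq_of_addv W p hp5 hadd
  have hM0 : M ≠ 0 := by
    intro h; rw [h, zero_mul] at hN; exact (W.conductorNorm_pos_holds).ne' hN
  -- `W^{(p*)} = C'' • V`
  set ps : ℚ := (-1 : ℚ) ^ (p / 2) * p with hps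
  have hps0 : ps ≠ 0 := pStar_ne_zero p
  have hcast : ((((-1 : ℤ) ^ (p / 2) * p : ℤ)) : ℚ) = ps := by rw [hps]; push_cast; ring
  haveI := V.isElliptic_quadraticTwist hps0
  obtain ⟨C₂, hC₂⟩ := V.exists_variableChange_quadraticTwist_mul_sq 1 ps hps0
  obtain ⟨C₀, hC₀⟩ := V.exists_variableChange_quadraticTwist_one
  have hW' : W.quadraticTwist ((((-1 : ℤ) ^ (p / 2) * p : ℤ)) : ℚ) =
      ((⟨C.u, ps * C.r, 0, 0⟩ : VariableChange ℚ) * C₂ * C₀) • V := by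
    rw [hcast, ← hC, WeierstrassCurve.quadraticTwist_smul, quadraticTwist_quadraticTwist, mul_smul, mul_smul, hC₀, hC₂,
      one_mul, sq]
  have hmult : (W.quadraticTwist (((-1 : ℤ) ^ (p / 2) * p : ℤ) : ℚ)).HasMultiplicativeReductionAtPrime p := by
    rw [hW']; exact (hasMultiplicativeReductionAtPrime_smul_iff V _ p).mpr hmultV
  have hsplit_iff : (W.quadraticTwist (((-1 : ℤ) ^ (p / 2) * p : ℤ) : ℚ)).HasSplitMultiplicativeReductionAtPrime p ↔
      V.HasSplitMultiplicativeReductionAtPrime p := by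
    rw [hW']; exact hasSplitMultiplicativeReductionAtPrime_smul_iff V _ p
  have hodd' : ∀ q ∈ M.primeFactors, q ≠ 2 → J((-1 : ℤ) ^ (p / 2) * p * d' | q) = 1 := by
    intro q hq hq2
    obtain ⟨hqprime, hqM⟩ := Nat.mem_primeFactors_of_ne_zero hM0 |>.mp hq
    have hqp : q ≠ p := by rintro rfl; exact hpM hqM
    exact hodd q hqprime (by rw [hN]; exact hqM.mul_right _) hqp hq2
  have htwo' : 2 ∣ M → ((-1 : ℤ) ^ (p / 2) * p * d') % 8 = 1 := fun h2 ↦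
    htwo (by rw [hN]; exact h2.mul_right _)
  rw [rootNumber_mul_rootNumber_ramifiedTwist_of_multTwist W p hmod hp5 hN hpM hmult hd'4 hd'sq hgcd hneg hodd' htwo']
  congr 1
  by_cases hs : V.HasSplitMultiplicativeReductionAtPrime p
  · rw [if_pos hs]
    exact localRootNumber_of_hasSplitMultiplicativeReduction ℤ_[p] _ (hsplit_iff.mpr hs)
  · rw [if_neg hs]
    exact localRootNumber_of_hasMultiplicativeReduction ℤ_[p] _ hmult (fun h ↦ hs (hsplit_iff.mp h))

end Sign

end Summit.BirchSwinnertonDyer.BirchSwinnertonDyer.Theorems.ThreeFieldRoadSupply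

end
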